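import Summits.Ventures.LatticeQCDFlow.Exactness.IMHCommonRandomNumbersMergedForever
import HarnessLib

/-!
# The law of the meeting time of two coupled flow-MCMC runs: the disagreement time has the geometric tail
# `P(T_M ≥ t) ≤ (1 − A)^{t−1}·P(X_0 ≠ X′_0)` and second moment `≤ P(X_0 ≠ X′_0)·W(2W − 1)`, from every initial coupling

HONEST FRAMING: exact (Metropolis-corrected) sampling algorithms for lattice gauge theory;
figures of merit are autocorrelation/cost numbers at stated couplings and volumes; no
continuum-physics claim.

Venture `LatticeQCDFlow` (cell pub-lqcd), topic `Exactness`; FANOUT row 30 (lean-1, GEN-38).  NEW WORK of the cell,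
general state space with `MeasurableEq Ω`; sequel to `Exactness/IMHCommonRandomNumbersMergedForever` (this generation: on
the pair path law `P̂_{μ̂₀}` of the CRN pair kernel `K̂` of `K = indepMH q w`, runs that have met stay together almost surely,
and `P̂(Z_n ∉ Δ) = (μ̂₀K̂ⁿ)(Δᶜ) ≤ rⁿ·P(X_0 ≠ X′_0)`, `r = 1 − A`, `A = 1/W`, `W = w(x₀)` for `w` normalised and maximal at `x₀`)
and to `Exactness/IMHCommonRandomNumbersMeetingTime` (GEN-37: `E[T_M] ≤ P(X_0 ≠ X′_0)·W` and Markov's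
`P(T_M ≥ t) ≤ P(X_0 ≠ X′_0)·W/t` for the disagreement time `T_M = #{n < M : X_n ≠ X′_n}`, recording «NOT CLAIMED: the law of
the meeting time beyond its expectation bound; the variance of `T_M`»).  Both are typed here:

* §1 **`offDiagonal_of_le_disagreementCount`** — pathwise: if merged runs stay merged along `z` and `T_M(z) ≥ t ≥ 1` then
  `z_{t−1} ∉ Δ` [bookkeeping]; **`crn_chain_disagreementCount_tail_le`** — THE GEOMETRIC TAIL: from every initial coupling, for
  every `M` and every `t ≥ 1`, `P̂(T_M ≥ t) ≤ r^{t−1}·P(X_0 ≠ X′_0)` — the hypothesis «geometric tails of the meeting time» of the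
  printed unbiased-estimator literature (Jacob–O'Leary–Atchadé, named only) is a THEOREM for the exact sampler, with ratio
  `1 − A`, where GEN-37 had Markov's `W/t`.
* §2 **`disagreementCount_sq_le`** — pathwise `T_M² ≤ Σ_{k<M}(2k + 1)·1{z_k ∉ Δ}` (`1_i·1_j ≤ 1_{max(i,j)}` and the pair count by
  the larger index, `Scoring/ChainMeanSquareError.sum_sum_max`) [bookkeeping]; **`crn_chain_integral_disagreementCount_sq_le`** —
  THE SECOND MOMENT: `E[T_M²] ≤ P(X_0 ≠ X′_0)·W(2W − 1)` uniformly in `M` (`Σ_{k<M}(2k + 1)r^k ≤ (1 + r)/(1 − r)² = W(2W − 1)`);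
  with GEN-37's `E[T_M] ≤ P(X_0 ≠ X′_0)·W` this bounds the variance of the coupled estimator's computing overhead.
Reading (gauge files): the number of updates on which two exact gauge samplers driven by one stream of random numbers differ
has a geometric tail with ratio `1 − A`, mean `≤ W` and second moment `≤ W(2W − 1)` (times the probability that they start
different).
NOT CLAIMED: the exact law of `T_M` (GEN-36 `IMHCommonRandomNumbersSharp`: geometric EXACTLY from (cold, off-mode) for an
atom-free proposal; here upper bounds from every coupling); exponential moments; optimality of `W(2W − 1)`; anything for two
different proposals or any value of `A`.  No `sorry`, no new definitions, nothing cited as a fact.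
-/

noncomputable section

namespace Summit.Ventures.LatticeQCDFlow.Exactness

open MeasureTheory ProbabilityTheory Function Finset Filter
open scoped ENNReal unitInterval Topology
open Summit.Ventures.LatticeQCDFlow.Scoring

variable {Ω : Type*} [MeasurableSpace Ω] {q : Measure Ω} [IsProbabilityMeasure q] {w : Ω → ℝ}

/-! ## §1 The geometric tail of the disagreement time -/

omit [MeasurableSpace Ω] in
/-- Pathwise: if merged runs stay merged along `z` and `T_M(z) = Σ_{n<M} 1{z_n ∉ Δ} ≥ t ≥ 1`, then `z_{t−1} ∉ Δ`. [ours,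
bookkeeping] -/
theorem offDiagonal_of_le_disagreementCount {z : ℕ → Ω × Ω}
    (hz : ∀ n m, n ≤ m → z n ∈ Set.diagonal Ω → z m ∈ Set.diagonal Ω) {M t : ℕ} (ht : 1 ≤ t)
    (hT : (t : ℝ) ≤ ∑ n ∈ Finset.range M, ((Set.diagonal Ω)ᶜ).indicator (1 : Ω × Ω → ℝ) (z n)) :
    z (t - 1) ∉ Set.diagonal Ω := by
  intro hmem
  -- every term with index `≥ t − 1` vanishes, the others are at most one
  have hterm : ∀ n ∈ Finset.range M, ((Set.diagonal Ω)ᶜ).indicator (1 : Ω × Ω → ℝ) (z n) ≤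
      if n < t - 1 then (1 : ℝ) else 0 := by
    intro n _
    by_cases hn : n < t - 1
    · rw [if_pos hn]
      exact Set.indicator_le_self' (fun _ _ => zero_le_one) _
    · rw [if_neg hn, Set.indicator_of_notMem]
      rw [Set.mem_compl_iff, not_not]
      exact hz (t - 1) n (Nat.le_of_not_lt hn) hmem
  have hsum : ∑ n ∈ Finset.range M, ((Set.diagonal Ω)ᶜ).indicator (1 : Ω × Ω → ℝ) (z n) ≤ (t - 1 : ℕ) := by
    refine (Finset.sum_le_sum hterm).trans ?_
    rw [Finset.sum_boole, Nat.cast_le]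
    calc ((Finset.range M).filter (fun n => n < t - 1)).card ≤ (Finset.range (t - 1)).card :=
          Finset.card_le_card fun n hn => by
            rw [Finset.mem_filter] at hn
            exact Finset.mem_range.2 hn.2
      _ = t - 1 := Finset.card_range _
  have hcast : ((t - 1 : ℕ) : ℝ) = (t : ℝ) - 1 := by
    rw [Nat.cast_sub ht, Nat.cast_one]
  linarith

/-- **THE GEOMETRIC TAIL OF THE DISAGREEMENT TIME**: from every initial coupling, for every `M` and every `t ≥ 1`,
`P̂(T_M ≥ t) ≤ r^{t−1}·P(X_0 ≠ X′_0)`, `T_M = Σ_{n<M} 1{X_n ≠ X′_n}` (`w` normalised, maximal at `x₀`, `r = 1 − 1/w(x₀)`). [ours] -/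
theorem crn_chain_disagreementCount_tail_le [MeasurableEq Ω] (hw : Measurable w) (hw0 : ∀ y, 0 < w y) {x₀ : Ω}
    (hmax : ∀ y, w y ≤ w x₀) [IsProbabilityMeasure (q.withDensity fun y => ENNReal.ofReal (w y))]
    (Khat : Kernel (Ω × Ω) (Ω × Ω)) [IsMarkovKernel Khat]
    (hK : ∀ z : Ω × Ω, Khat z = (q.prod (volume : Measure unitInterval)).map (fun p : Ω × unitInterval =>
      ((if (p.2 : ℝ) * w z.1 ≤ w p.1 then p.1 else z.1), (if (p.2 : ℝ) * w z.2 ≤ w p.1 then p.1 else z.2))))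
    (μ₀ : Measure (Ω × Ω)) [IsProbabilityMeasure μ₀] (M : ℕ) {t : ℕ} (ht : 1 ≤ t) :
    (Kernel.trajMeasure (X := fun _ : ℕ => Ω × Ω) μ₀
          (fun n : ℕ => Khat.comap (fun h : (i : ↥(Finset.Iic n)) → Ω × Ω => h ⟨n, Finset.mem_Iic.2 le_rfl⟩)
            (measurable_pi_apply _))).real
        {z | (t : ℝ) ≤ ∑ n ∈ Finset.range M, ((Set.diagonal Ω)ᶜ).indicator (1 : Ω × Ω → ℝ) (z n)} ≤
      (1 - (w x₀)⁻¹) ^ (t - 1) * μ₀.real (Set.diagonal Ω)ᶜ := by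
  set P := Kernel.trajMeasure (X := fun _ : ℕ => Ω × Ω) μ₀
      (fun n : ℕ => Khat.comap (fun h : (i : ↥(Finset.Iic n)) → Ω × Ω => h ⟨n, Finset.mem_Iic.2 le_rfl⟩)
        (measurable_pi_apply _)) with hP
  have hsub : P {z | (t : ℝ) ≤ ∑ n ∈ Finset.range M, ((Set.diagonal Ω)ᶜ).indicator (1 : Ω × Ω → ℝ) (z n)} ≤
      P {z | z (t - 1) ∉ Set.diagonal Ω} := by
    refine measure_mono_ae ?_
    filter_upwards [crn_chain_ae_merged_stay hw hw0 Khat hK μ₀] with z hz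
    intro hT
    exact offDiagonal_of_le_disagreementCount hz ht hT
  calc P.real {z | (t : ℝ) ≤ ∑ n ∈ Finset.range M, ((Set.diagonal Ω)ᶜ).indicator (1 : Ω × Ω → ℝ) (z n)}
      ≤ P.real {z | z (t - 1) ∉ Set.diagonal Ω} := by
        simp only [measureReal_def]; exact ENNReal.toReal_mono (measure_ne_top _ _) hsub
    _ = ((fun m : Measure (Ω × Ω) => m.bind Khat)^[t - 1] μ₀).real (Set.diagonal Ω)ᶜ := by
        rw [hP]; exact crn_chain_offDiagonal_real_eq Khat μ₀ (t - 1)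
    _ ≤ (1 - (w x₀)⁻¹) ^ (t - 1) * μ₀.real (Set.diagonal Ω)ᶜ :=
        iterate_bind_crnPair_offDiagonal_le hw hw0 hmax Khat hK (t - 1) μ₀

/-! ## §2 The second moment of the disagreement time -/

omit [MeasurableSpace Ω] in
/-- Pathwise: `(Σ_{n<M} 1{z_n ∉ Δ})² ≤ Σ_{k<M} (2k + 1)·1{z_k ∉ Δ}` (`1_i 1_j ≤ 1_{max(i,j)}` and the pair count by the larger
index). [ours, bookkeeping] -/
theorem disagreementCount_sq_le (z : ℕ → Ω × Ω) (M : ℕ) :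
    (∑ n ∈ Finset.range M, ((Set.diagonal Ω)ᶜ).indicator (1 : Ω × Ω → ℝ) (z n)) ^ 2 ≤
      ∑ k ∈ Finset.range M, (2 * (k : ℝ) + 1) * ((Set.diagonal Ω)ᶜ).indicator (1 : Ω × Ω → ℝ) (z k) := by
  set a : ℕ → ℝ := fun n => ((Set.diagonal Ω)ᶜ).indicator (1 : Ω × Ω → ℝ) (z n) with ha
  have ha0 : ∀ n, 0 ≤ a n := fun n => Set.indicator_nonneg (fun _ _ => zero_le_one) _
  have ha1 : ∀ n, a n ≤ 1 := fun n => Set.indicator_le_self' (fun _ _ => zero_le_one) _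
  have hpair : ∀ i j, a i * a j ≤ a (max i j) := by
    intro i j
    rcases le_total i j with hij | hji
    · rw [max_eq_right hij]
      calc a i * a j ≤ 1 * a j := mul_le_mul_of_nonneg_right (ha1 i) (ha0 j)
        _ = a j := one_mul _
    · rw [max_eq_left hji]
      calc a i * a j ≤ a i * 1 := mul_le_mul_of_nonneg_left (ha1 j) (ha0 i)
        _ = a i := mul_one _
  show (∑ n ∈ Finset.range M, a n) ^ 2 ≤ ∑ k ∈ Finset.range M, (2 * (k : ℝ) + 1) * a k
  rw [sq, Finset.sum_mul_sum, ← sum_sum_max a M]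
  exact Finset.sum_le_sum fun i _ => Finset.sum_le_sum fun j _ => hpair i j

/-- **THE SECOND MOMENT OF THE DISAGREEMENT TIME**: from every initial coupling and for every `M`,
`E[T_M²] ≤ P(X_0 ≠ X′_0)·w(x₀)(2w(x₀) − 1)`, `T_M = Σ_{n<M} 1{X_n ≠ X′_n}` (`w` measurable as a `Fact`, normalised, maximal at
`x₀`). [ours] -/
theorem crn_chain_integral_disagreementCount_sq_le [MeasurableEq Ω] [Fact (Measurable w)] (hw0 : ∀ y, 0 < w y) {x₀ : Ω}
    (hmax : ∀ y, w y ≤ w x₀) [IsProbabilityMeasure (q.withDensity fun y => ENNReal.ofReal (w y))]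
    (Khat : Kernel (Ω × Ω) (Ω × Ω)) [IsMarkovKernel Khat]
    (hK : ∀ z : Ω × Ω, Khat z = (q.prod (volume : Measure unitInterval)).map (fun p : Ω × unitInterval =>
      ((if (p.2 : ℝ) * w z.1 ≤ w p.1 then p.1 else z.1), (if (p.2 : ℝ) * w z.2 ≤ w p.1 then p.1 else z.2))))
    (μ₀ : Measure (Ω × Ω)) [IsProbabilityMeasure μ₀] (M : ℕ) :
    ∫ z, (∑ n ∈ Finset.range M, ((Set.diagonal Ω)ᶜ).indicator (1 : Ω × Ω → ℝ) (z n)) ^ 2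
        ∂(Kernel.trajMeasure (X := fun _ : ℕ => Ω × Ω) μ₀
          (fun n : ℕ => Khat.comap (fun h : (i : ↥(Finset.Iic n)) → Ω × Ω => h ⟨n, Finset.mem_Iic.2 le_rfl⟩)
            (measurable_pi_apply _))) ≤ μ₀.real (Set.diagonal Ω)ᶜ * (w x₀ * (2 * w x₀ - 1)) := by
  set P := Kernel.trajMeasure (X := fun _ : ℕ => Ω × Ω) μ₀
      (fun n : ℕ => Khat.comap (fun h : (i : ↥(Finset.Iic n)) → Ω × Ω => h ⟨n, Finset.mem_Iic.2 le_rfl⟩)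
        (measurable_pi_apply _)) with hP
  have hw : Measurable w := Fact.out
  have hW : 1 ≤ w x₀ := one_le_of_mode (q := q) hmax
  have hWpos : 0 < w x₀ := hw0 x₀
  have hr0 : 0 ≤ 1 - (w x₀)⁻¹ := sub_nonneg.2 (inv_le_one_of_one_le₀ hW)
  have hr1 : 1 - (w x₀)⁻¹ < 1 := sub_lt_self _ (inv_pos.2 hWpos)
  have hD : MeasurableSet (Set.diagonal Ω) := measurableSet_diagonal
  have hIm : Measurable ((Set.diagonal Ω)ᶜ.indicator (1 : Ω × Ω → ℝ)) := measurable_one.indicator hD.compl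
  have hIb : ∀ p : Ω × Ω, |(Set.diagonal Ω)ᶜ.indicator (1 : Ω × Ω → ℝ) p| ≤ 1 := by
    intro p
    by_cases hp : p ∈ (Set.diagonal Ω)ᶜ
    · rw [Set.indicator_of_mem hp, Pi.one_apply, abs_one]
    · rw [Set.indicator_of_notMem hp, abs_zero]; exact zero_le_one
  have hInn : ∀ p : Ω × Ω, 0 ≤ (Set.diagonal Ω)ᶜ.indicator (1 : Ω × Ω → ℝ) p := fun p =>
    Set.indicator_nonneg (fun _ _ => zero_le_one) _
  have hIi : ∀ n, Integrable (fun z : ℕ → Ω × Ω => (Set.diagonal Ω)ᶜ.indicator (1 : Ω × Ω → ℝ) (z n)) P := fun n =>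
    integrable_of_bounded P (hIm.comp (measurable_pi_apply n)) (fun z => hIb _)
  -- the square is bounded by `M²`, hence integrable
  have hTm : Measurable (fun z : ℕ → Ω × Ω => ∑ n ∈ range M, (Set.diagonal Ω)ᶜ.indicator (1 : Ω × Ω → ℝ) (z n)) :=
    Finset.measurable_sum _ fun n _ => hIm.comp (measurable_pi_apply n)
  have hTnn : ∀ z : ℕ → Ω × Ω, 0 ≤ ∑ n ∈ range M, (Set.diagonal Ω)ᶜ.indicator (1 : Ω × Ω → ℝ) (z n) := fun z =>
    sum_nonneg fun n _ => hInn _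
  have hTle : ∀ z : ℕ → Ω × Ω, ∑ n ∈ range M, (Set.diagonal Ω)ᶜ.indicator (1 : Ω × Ω → ℝ) (z n) ≤ M := fun z =>
    calc ∑ n ∈ range M, (Set.diagonal Ω)ᶜ.indicator (1 : Ω × Ω → ℝ) (z n) ≤ ∑ n ∈ range M, (1 : ℝ) :=
          sum_le_sum fun n _ => Set.indicator_le_self' (fun _ _ => zero_le_one) _
      _ = M := by rw [sum_const, card_range, nsmul_eq_mul, mul_one]
  have hSqi : Integrable (fun z : ℕ → Ω × Ω => (∑ n ∈ range M, (Set.diagonal Ω)ᶜ.indicator (1 : Ω × Ω → ℝ) (z n)) ^ 2) P :=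
    integrable_of_bounded P (hTm.pow_const 2) (C := (M : ℝ) ^ 2) (fun z => by
      rw [abs_of_nonneg (sq_nonneg _)]
      exact pow_le_pow_left₀ (hTnn z) (hTle z) 2)
  have hRi : Integrable (fun z : ℕ → Ω × Ω =>
      ∑ k ∈ range M, (2 * (k : ℝ) + 1) * (Set.diagonal Ω)ᶜ.indicator (1 : Ω × Ω → ℝ) (z k)) P :=
    integrable_finsetSum _ fun k _ => (hIi k).const_mul _
  -- one-time marginals and the contraction
  have hterm : ∀ k, ∫ z, (Set.diagonal Ω)ᶜ.indicator (1 : Ω × Ω → ℝ) (z k) ∂P ≤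
      (1 - (w x₀)⁻¹) ^ k * μ₀.real (Set.diagonal Ω)ᶜ := by
    intro k
    haveI := isProbabilityMeasure_iterate_bind (κ := Khat) μ₀ k
    rw [hP, chain_expect_eq_integral_iterate_bind Khat μ₀ hIm hIb k, integral_indicator_one hD.compl]
    exact iterate_bind_crnPair_offDiagonal_le hw hw0 hmax Khat hK k μ₀
  have hgeom : (1 + (1 - (w x₀)⁻¹)) / (1 - (1 - (w x₀)⁻¹)) ^ 2 = w x₀ * (2 * w x₀ - 1) := by
    field_simp
    ring
  calc ∫ z, (∑ n ∈ range M, (Set.diagonal Ω)ᶜ.indicator (1 : Ω × Ω → ℝ) (z n)) ^ 2 ∂P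
      ≤ ∫ z, ∑ k ∈ range M, (2 * (k : ℝ) + 1) * (Set.diagonal Ω)ᶜ.indicator (1 : Ω × Ω → ℝ) (z k) ∂P :=
        integral_mono hSqi hRi fun z => disagreementCount_sq_le z M
    _ = ∑ k ∈ range M, (2 * (k : ℝ) + 1) * ∫ z, (Set.diagonal Ω)ᶜ.indicator (1 : Ω × Ω → ℝ) (z k) ∂P := by
        rw [integral_finsetSum _ fun k _ => (hIi k).const_mul _]
        exact sum_congr rfl fun k _ => integral_const_mul _ _
    _ ≤ ∑ k ∈ range M, (2 * (k : ℝ) + 1) * ((1 - (w x₀)⁻¹) ^ k * μ₀.real (Set.diagonal Ω)ᶜ) :=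
        sum_le_sum fun k _ => mul_le_mul_of_nonneg_left (hterm k) (by positivity)
    _ = μ₀.real (Set.diagonal Ω)ᶜ * ∑ k ∈ range M, (2 * (k : ℝ) + 1) * (1 - (w x₀)⁻¹) ^ k := by
        rw [mul_sum]; exact sum_congr rfl fun k _ => by ring
    _ ≤ μ₀.real (Set.diagonal Ω)ᶜ * ((1 + (1 - (w x₀)⁻¹)) / (1 - (1 - (w x₀)⁻¹)) ^ 2) :=
        mul_le_mul_of_nonneg_left (sum_range_odd_mul_pow_le hr0 hr1 M) measureReal_nonneg
    _ = μ₀.real (Set.diagonal Ω)ᶜ * (w x₀ * (2 * w x₀ - 1)) := by rw [hgeom]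

end Summit.Ventures.LatticeQCDFlow.Exactness

end
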